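import Summits.BirchSwinnertonDyer.BirchSwinnertonDyer.Theorems.KolyvaginRoadThreeClassCertificate
import Summits.BirchSwinnertonDyer.Rank1Residual.X11b.Three.KolyvaginH44AtThree
import HarnessLib

/-!
# Route `KolyvaginRoadThree`, crux `ZhangSharpFrameAtThree` (item stmt-BirchSwinnertonDyer-19153):
# the invariance clause of the point-certificate form SUPPLIED at ZHANG–Kolyvagin levels, and the crux
# from ONE derived-point certificate on a tower of Kolyvagin–Heegner data (cell `bsd-stepL`, seat
# `bsd-stepL-zhang3-p1`; `--supports 19153`, helper)

THEOREMS ONLY (no definition, no named fact, no `sorry`); nothing about Kolyvagin's conjecture at `p = 3`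
is asserted; nothing is booked.

`Theorems/KolyvaginRoadThreeClassCertificate.lean` (p417973) reads the crux as
`∀ frame, ∃ n ∈ Λ₃, ∃ d, [P(n)] Γ_K-invariant mod 3 ∧ P(n) ∉ 3·E(K[n])`
(`KolyCert.zhangSharpFrameAtThree_iff_pointCertificates`).  The invariance clause is McCallum 1991, (4)
/ Gross 1991, Prop. 3.6 — a CONSEQUENCE of the Euler-system relations at a Kolyvagin level.  The tree
supplies it (`KolyvaginH44.kolyvaginPoint_mem_invPoints_of_dvd`, x11b3) for GROSS's Kolyvagin primes
(`IsKolyvaginPrime` with the Frobenius condition (3.2) `FrobEqFrobInfty`), whereas the crux is typed with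
W. ZHANG's Kolyvagin primes (`Zhang2014.IsKolyvaginPrime`: the congruence index `M(ℓ) ≥ 1`, i.e. Gross's
(3.3) `a_ℓ ≡ ℓ + 1 ≡ 0 (mod p)`).  The x11b3 chain uses (3.2) ONLY through (3.3)
(`IsKolyvaginPrime.pow_dvd_add_one`, `pow_dvd_frobeniusTraceAt_of_frobEqFrobInfty`), so it re-runs
verbatim on Zhang's primes with `p^M ∣ ℓ + 1`, `p^M ∣ a_ℓ` read off `Zhang2014.le_kolyvaginIndex_iff`:

* §1 (abstract Euler data, any `p`, `M ≥ 1`): `KolyCert.pow_succ_eq_one_of_dvd_of_inert`,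
  `KolyCert.grAct_traceElt_mem_of_dvd_zhang`, `KolyCert.smul_kolyvaginPoint_sub_mem_of_dvd_zhang`,
  `KolyCert.kolyvaginPoint_mem_invPoints_of_dvd_zhang` — the x11b3 theorems of
  `X11b/KolyvaginPointClassFixed.lean` with `hkol` re-typed to
  `Zhang2014.IsKolyvaginPrime N W K p q ∧ M ≤ Zhang2014.kolyvaginIndex W p q`; proofs copied, the (3.3)
  block replaced; the trace relation (Gross Prop. 3.7 (1)) is the tree THEOREM
  `HeegnerTrace.sum_pow_pointGalHom_y_eq_lFunction_smul_map`.
* §2 (concrete data): `KolyCert.toGeomPoints_derivedPoint_mem_invPoints_of_dvd_zhang` — for a family of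
  Kolyvagin–Heegner data `d m` at the divisors `m ∣ n` of a square-free product of Zhang–Kolyvagin primes
  of index `≥ M`, `[P(m)]` is `Γ_K`-invariant mod `p^M` at every `m ∣ n` (the instantiation at
  `KolyvaginH44.exists_levelData` + `KolyvaginH37Bridge.map_kolyvaginPoint_eq_derivedPoint`, exactly as in
  `Three.h44_concrete_at_three_of_congruence`).
* §3 (the crux): `KolyCert.kolyvaginClass_three_ne_zero_of_tower_not_pDiv` — on the crux's binders
  (`3 ∥ N` multiplicative, `Surj W 3`, `K` imaginary quadratic Heegner), ONE tower `d m (m ∣ n)` on the frame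
  with `n ∈ Λ₃` and `P(n) ∉ 3·E(K[n])` gives `c₁(n) ≠ 0`; and
  `KolyCert.zhangSharpFrameAtThree_of_towerCertificates` — **the crux follows from: at every Manin-good
  conductor-1 frame some tower of Kolyvagin–Heegner data over a level `n ∈ Λ₃` has `3 ∤ P(n)` in
  `E(K[n])`** — a pure point-divisibility statement (no cohomology, no invariance clause), the shape a
  derived-point computation (BC5 rung `stub_rung_347253a1`, WANTED-K3) certifies.  The converse needs data
  at the lower levels (CM rationality of `x_m`, Gross 1991 §3 — the seam G-a shape at level `m`) and is
  not claimed.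

References (locators only): [cite: McCallumLMS1991, §4 (4), Cor. 4.5]
[cite: GrossLMS1991, §3 (3.3)–(3.5), Prop. 3.6, Prop. 3.7 (1), §4 (4.1), Lemma 4.3]
[cite: WZhang2014, Notations (xii) (p. 202)].
-/

noncomputable section

open scoped Classical
open WeierstrassCurve Field NumberField IsDedekindDomain Finset
open Literature.NumberTheory.EllipticCurves Literature.NumberTheory.GaloisRepresentations
open Literature.NumberTheory.EllipticCurves.KolyvaginCocycle
open Literature.NumberTheory.EllipticCurves.KolyvaginEuler
open Literature.NumberTheory.EllipticCurves.RingClassField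
open Literature.NumberTheory.EllipticCurves.ModularForms
open Summit.BirchSwinnertonDyer.Rank1Residual.X11b.Three.Koly

namespace Summit.BirchSwinnertonDyer.Rank1Residual.X11b.Three.KolyCert

-- `K : Type`: the tree's ring-class class field theory is universe `0`.
variable {K : Type} [Field K] [NumberField K] {N : ℕ} {W : WeierstrassCurve ℚ}

/-! ## §1 The x11b3 `hPt` chain re-typed to Zhang–Kolyvagin primes (abstract Euler data) -/

/-- `σ_m ℓ ^ (ℓ + 1) = 1` for `m ∣ n`, `ℓ ∣ m` (x11b3's `KolyvaginH44.pow_succ_eq_one_of_dvd` with its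
Kolyvagin-prime binder weakened to what the proof uses: the prime factors of `n` are INERT in `K`).
Gross 1991, §3: "`G_ℓ` … cyclic of order `ℓ + 1`". [cite: GrossLMS1991, §3 (chunk 217 L1)] -/
theorem pow_succ_eq_one_of_dvd_of_inert (hK : IsImaginaryQuadratic K) (ι : K →+* ℂ) [NeZero N]
    (Dt : ModularParametrizationData W N) {β : ℤ} {n : ℕ} (hn : Squarefree n)
    (hinert : ∀ q ∈ n.primeFactors, (Ideal.span {(q : 𝓞 K)}).IsPrime)
    (d : (m : ℕ) → m ∣ n → KolyvaginHeegnerData Dt β ι m)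
    {𝒢 : ℕ → Type*} [∀ m, CommGroup (𝒢 m)] (σ : ∀ m, ℕ → 𝒢 m) (L : ℕ → Finset ℕ)
    (ρ : ∀ m, 𝒢 m →* (ringClassField K ι m ≃ₐ[ℚ] ringClassField K ι m))
    (hρ : ∀ m, Function.Injective (ρ m))
    (hσA : ∀ (m : ℕ) (hm : m ∣ n), ∀ q ∈ m.primeFactors, ρ m (σ m q) = (d m hm).σ q)
    (hL : ∀ m : ℕ, m ∣ n → L m = m.primeFactors) :
    ∀ m : ℕ, m ∣ n → ∀ ℓ ∈ L m, σ m ℓ ^ (ℓ + 1) = 1 := by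
  intro m hm ℓ hℓ
  have hm0 : m ≠ 0 := ne_zero_of_dvd_ne_zero hn.ne_zero hm
  rw [hL m hm] at hℓ
  obtain ⟨hℓp, hℓm, -⟩ := Nat.mem_primeFactors.mp hℓ
  have hℓm' : ¬ ℓ ∣ m / ℓ :=
    KolyvaginH44.not_dvd_div_of_squarefree_of_prime (hn.squarefree_of_dvd hm) hℓp hℓm
  have hin := hinert ℓ (Nat.primeFactors_mono hm hn.ne_zero hℓ)
  have hmem : ρ m (σ m ℓ) ∈ ringClassGalOver ι m (m / ℓ) := by
    rw [hσA m hm ℓ hℓ, ← (d m hm).zpowers_σ ℓ hℓ]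
    exact Subgroup.mem_zpowers _
  have h := RingClassTower.pow_succ_eq_one_of_mem_ringClassGalOver hK ι hm0 hℓp hℓm hℓm' hin hmem
  exact hρ m (by rw [map_pow, h, map_one])

/-- **`Tr_ℓ y_m ∈ p^M A₀ m` at the divisors of a square-free product of ZHANG–Kolyvagin primes of index
`≥ M`** (x11b3's `KolyvaginH44.grAct_traceElt_mem_of_dvd` re-typed): Gross Prop. 3.7 (1)
`Tr_ℓ y(m) = a_ℓ · y(m/ℓ)↑` (tree THEOREM `HeegnerTrace.sum_pow_pointGalHom_y_eq_lFunction_smul_map`) and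
`p^M ∣ a_ℓ` from `M ≤ M(ℓ)` (`Zhang2014.le_kolyvaginIndex_iff`, printed `M(ℓ) = min{v_p(ℓ+1), v_p(a_ℓ)}`),
transferred to `A₀ m` along the equivariant `iA m`. [cite: GrossLMS1991, Prop. 3.7 (1), §3 (3.3)]
[cite: WZhang2014, Notations (xii)] -/
theorem grAct_traceElt_mem_of_dvd_zhang (hK : IsImaginaryQuadratic K) (ι : K →+* ℂ) [NeZero N]
    [W.IsElliptic] [W.IsGloballyMinimal] (Dt : ModularParametrizationData W N) {β : ℤ} {p M : ℕ}
    (hp : p.Prime) (hND : IsCoprime (N : ℤ) (NumberField.discr K)) (hD : NumberField.discr K < -4)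
    {n : ℕ} (hn : Squarefree n)
    (hkol : ∀ q ∈ n.primeFactors,
      Zhang2014.IsKolyvaginPrime N W K p q ∧ M ≤ Zhang2014.kolyvaginIndex W p q)
    (d : (m : ℕ) → m ∣ n → KolyvaginHeegnerData Dt β ι m)
    {𝒢 : ℕ → Type*} [∀ m, CommGroup (𝒢 m)] {A₀ : ℕ → Type*} [∀ m, AddCommGroup (A₀ m)]
    [∀ m, DistribMulAction (𝒢 m) (A₀ m)]
    (σ : ∀ m, ℕ → 𝒢 m) (L : ℕ → Finset ℕ) (y : ∀ m, A₀ m)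
    (ρ : ∀ m, 𝒢 m →* (ringClassField K ι m ≃ₐ[ℚ] ringClassField K ι m))
    (iA : ∀ m, A₀ m ≃+ (W.baseChange (ringClassField K ι m)).toAffine.Point)
    (hiA : ∀ (m : ℕ), m ∣ n → ∀ (g : 𝒢 m) (a : A₀ m),
      iA m (g • a) = pointGalHom W (ringClassField K ι m) (ρ m g) (iA m a))
    (hyA : ∀ (m : ℕ) (hm : m ∣ n), iA m (y m) = (d m hm).y)
    (hσA : ∀ (m : ℕ) (hm : m ∣ n), ∀ q ∈ m.primeFactors, ρ m (σ m q) = (d m hm).σ q)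
    (hL : ∀ m : ℕ, m ∣ n → L m = m.primeFactors) :
    ∀ m : ℕ, m ∣ n → ∀ ℓ ∈ L m,
      grAct (A₀ m) (traceElt (σ m ℓ) ℓ) (y m) ∈ zsmulRange (A₀ m) ((p ^ M : ℕ) : ℤ) := by
  intro m hm ℓ hℓ
  have hn0 := hn.ne_zero
  have hm0 : m ≠ 0 := ne_zero_of_dvd_ne_zero hn0 hm
  rw [hL m hm] at hℓ
  obtain ⟨hℓp, hℓm, -⟩ := Nat.mem_primeFactors.mp hℓ
  obtain ⟨hℓK, hℓM⟩ := hkol ℓ (Nat.primeFactors_mono hm hn0 hℓ)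
  have hℓm' : ¬ ℓ ∣ m / ℓ :=
    KolyvaginH44.not_dvd_div_of_squarefree_of_prime (hn.squarefree_of_dvd hm) hℓp hℓm
  have hm' : m / ℓ ∣ n := (Nat.div_dvd_of_dvd hℓm).trans hm
  have hle : ringClassField K ι (m / ℓ) ≤ ringClassField K ι m :=
    ringClassField_mono hK ι (Nat.div_dvd_of_dvd hℓm) hm0
  have hNm : Nat.Coprime N m := KolyvaginH37Bridge.coprime_of_forall_not_dvd hm0
    fun q hq => (hkol q (Nat.primeFactors_mono hm hn0 hq)).1.2.1
  haveI : Fact ℓ.Prime := ⟨hℓp⟩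
  haveI : Fact p.Prime := ⟨hp⟩
  -- (β2): Gross Prop. 3.7 (1) for the tree's data, in `a_ℓ = W.frobeniusTrace ℓ` currency
  have hgood : W.HasGoodReductionAtPrime ℓ :=
    KolyvaginH37Bridge.hasGoodReductionAtPrime_of_modularParametrizationData Dt hℓK.2.1
  have htr := HeegnerTrace.frobeniusTrace_smul_eq_of_lFunction_smul_eq hgood
    (HeegnerTrace.sum_pow_pointGalHom_y_eq_lFunction_smul_map hK ι hND hℓ hℓK.2.2.2.2.1 hℓK.2.1
      hℓm' hNm (Or.inr hD) (d m hm) (d (m / ℓ) hm') hle)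
  -- (3.3) from Zhang's index: `p^M ∣ a_ℓ`
  have haℓ : ((p ^ M : ℕ) : ℤ) ∣ W.frobeniusTrace ℓ := by
    have h := ((Zhang2014.le_kolyvaginIndex_iff (W := W) (p := p) (M := M) (ℓ := ℓ)).mp hℓM).2
    exact_mod_cast h
  -- transfer to `A₀ m` along the injective equivariant `iA m`
  have hrel : grAct (A₀ m) (traceElt (σ m ℓ) ℓ) (y m) =
      W.frobeniusTrace ℓ • (iA m).symm (WeierstrassCurve.Affine.Point.map (W' := W)
        ((RingClassField.inclusion ι hle).restrictScalars ℚ) (d (m / ℓ) hm').y) := by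
    apply (iA m).injective
    rw [grAct_traceElt, map_sum, map_zsmul, AddEquiv.apply_symm_apply]
    simp_rw [hiA m hm, map_pow (ρ m), hσA m hm ℓ hℓ, hyA m hm]
    exact htr
  exact grAct_traceElt_mem_of_eq_smul hrel haℓ

/-- **McCallum's (4) / Gross's Prop. 3.6 at the divisors of a square-free product of ZHANG–Kolyvagin
primes of index `≥ M`**: `γ P_m − P_m ∈ p^M A₀ m` for every `γ ∈ 𝒢_m`, `m ∣ n` (x11b3's
`KolyvaginH44.smul_kolyvaginPoint_sub_mem_of_dvd` re-typed; the group-ring identity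
`(σ_ℓ − 1) D_ℓ = ℓ + 1 − Tr_ℓ`, `KolyvaginEuler.smul_kolyvaginPoint_sub_mem`, fed with
`pow_succ_eq_one_of_dvd_of_inert`, `KolyvaginH44.le_closure_of_dvd`, `p^M ∣ ℓ + 1` from Zhang's index and
`grAct_traceElt_mem_of_dvd_zhang`). [cite: GrossLMS1991, Prop. 3.6, §3 (3.5), §4 (4.1)]
[cite: McCallumLMS1991, §4 (4)] -/
theorem smul_kolyvaginPoint_sub_mem_of_dvd_zhang (hK : IsImaginaryQuadratic K) (ι : K →+* ℂ)
    [NeZero N] [W.IsElliptic] [W.IsGloballyMinimal] (Dt : ModularParametrizationData W N) {β : ℤ}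
    {p M : ℕ} (hp : p.Prime)
    (hND : IsCoprime (N : ℤ) (NumberField.discr K)) (hD : NumberField.discr K < -4) {n : ℕ}
    (hn : Squarefree n)
    (hkol : ∀ q ∈ n.primeFactors,
      Zhang2014.IsKolyvaginPrime N W K p q ∧ M ≤ Zhang2014.kolyvaginIndex W p q)
    (d : (m : ℕ) → m ∣ n → KolyvaginHeegnerData Dt β ι m)
    {𝒢 : ℕ → Type*} [∀ m, CommGroup (𝒢 m)] {A₀ : ℕ → Type*} [∀ m, AddCommGroup (A₀ m)]
    [∀ m, DistribMulAction (𝒢 m) (A₀ m)]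
    (σ : ∀ m, ℕ → 𝒢 m) (L : ℕ → Finset ℕ) (H : ∀ m, Subgroup (𝒢 m))
    [∀ m, Fintype (𝒢 m ⧸ H m)] (f : ∀ m, 𝒢 m ⧸ H m → 𝒢 m) (y : ∀ m, A₀ m)
    (ρ : ∀ m, 𝒢 m →* (ringClassField K ι m ≃ₐ[ℚ] ringClassField K ι m))
    (hρ : ∀ m, Function.Injective (ρ m))
    (iA : ∀ m, A₀ m ≃+ (W.baseChange (ringClassField K ι m)).toAffine.Point)
    (hiA : ∀ (m : ℕ), m ∣ n → ∀ (g : 𝒢 m) (a : A₀ m),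
      iA m (g • a) = pointGalHom W (ringClassField K ι m) (ρ m g) (iA m a))
    (hyA : ∀ (m : ℕ) (hm : m ∣ n), iA m (y m) = (d m hm).y)
    (hσA : ∀ (m : ℕ) (hm : m ∣ n), ∀ q ∈ m.primeFactors, ρ m (σ m q) = (d m hm).σ q)
    (hL : ∀ m : ℕ, m ∣ n → L m = m.primeFactors)
    (hfsec : ∀ m : ℕ, m ∣ n → ∀ c : 𝒢 m ⧸ H m, (f m c : 𝒢 m ⧸ H m) = c)
    (hHρ : ∀ m : ℕ, m ∣ n → ∀ h ∈ H m, ρ m h ∈ ringClassGalOver ι m 1) :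
    ∀ m : ℕ, m ∣ n → ∀ γ : 𝒢 m,
      γ • kolyvaginPoint (σ m) (L m) (f m) (y m) - kolyvaginPoint (σ m) (L m) (f m) (y m) ∈
        zsmulRange (A₀ m) ((p ^ M : ℕ) : ℤ) := by
  intro m hm γ
  haveI : Fact p.Prime := ⟨hp⟩
  have hinert : ∀ q ∈ n.primeFactors, (Ideal.span {(q : 𝓞 K)}).IsPrime :=
    fun q hq ↦ (hkol q hq).1.2.2.2.2.1
  have hdvd : ∀ ℓ ∈ L m, ((p ^ M : ℕ) : ℤ) ∣ ((ℓ + 1 : ℕ) : ℤ) := by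
    intro ℓ hℓ
    rw [hL m hm] at hℓ
    obtain ⟨-, hℓM⟩ := hkol ℓ (Nat.primeFactors_mono hm hn.ne_zero hℓ)
    exact Int.natCast_dvd_natCast.mpr
      ((Zhang2014.le_kolyvaginIndex_iff (W := W) (p := p) (M := M) (ℓ := ℓ)).mp hℓM).1
  exact smul_kolyvaginPoint_sub_mem (hfsec m hm)
    (KolyvaginH44.le_closure_of_dvd hK ι Dt hn d σ L H ρ hρ hσA hL hHρ m hm)
    (pow_succ_eq_one_of_dvd_of_inert hK ι Dt hn hinert d σ L ρ hρ hσA hL m hm)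
    hdvd
    (grAct_traceElt_mem_of_dvd_zhang hK ι Dt hp hND hD hn hkol d σ L y ρ iA hiA hyA hσA hL m hm) γ

/-- **`hPt` at the divisors of a square-free product of ZHANG–Kolyvagin primes of index `≥ M`**:
`j_m P_m ∈ invPoints Γ_K (j_m A₀ m) p^M` (x11b3's `KolyvaginH44.kolyvaginPoint_mem_invPoints_of_dvd`
re-typed; `KolyvaginEuler.map_mem_invPoints_of_forall_smul_sub_mem`). [cite: McCallumLMS1991, §4 (4)]
[cite: GrossLMS1991, Prop. 3.6, §4 (4.1)] -/
theorem kolyvaginPoint_mem_invPoints_of_dvd_zhang (hK : IsImaginaryQuadratic K) (ι : K →+* ℂ)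
    [NeZero N] [W.IsElliptic] [W.IsGloballyMinimal] (Dt : ModularParametrizationData W N) {β : ℤ}
    {p M : ℕ} (hp : p.Prime)
    (hND : IsCoprime (N : ℤ) (NumberField.discr K)) (hD : NumberField.discr K < -4) {n : ℕ}
    (hn : Squarefree n)
    (hkol : ∀ q ∈ n.primeFactors,
      Zhang2014.IsKolyvaginPrime N W K p q ∧ M ≤ Zhang2014.kolyvaginIndex W p q)
    (d : (m : ℕ) → m ∣ n → KolyvaginHeegnerData Dt β ι m)
    {𝒢 : ℕ → Type*} [∀ m, CommGroup (𝒢 m)] {A₀ : ℕ → Type*} [∀ m, AddCommGroup (A₀ m)]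
    [∀ m, DistribMulAction (𝒢 m) (A₀ m)]
    (σ : ∀ m, ℕ → 𝒢 m) (L : ℕ → Finset ℕ) (H : ∀ m, Subgroup (𝒢 m))
    [∀ m, Fintype (𝒢 m ⧸ H m)] (f : ∀ m, 𝒢 m ⧸ H m → 𝒢 m) (y : ∀ m, A₀ m)
    (π : ∀ m, absoluteGaloisGroup K →* 𝒢 m) (j : ∀ m, A₀ m →+ geomPoints (W.baseChange K))
    (hj : ∀ m (g : absoluteGaloisGroup K) (a : A₀ m), j m (π m g • a) = g • j m a)
    (ρ : ∀ m, 𝒢 m →* (ringClassField K ι m ≃ₐ[ℚ] ringClassField K ι m))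
    (hρ : ∀ m, Function.Injective (ρ m))
    (iA : ∀ m, A₀ m ≃+ (W.baseChange (ringClassField K ι m)).toAffine.Point)
    (hiA : ∀ (m : ℕ), m ∣ n → ∀ (g : 𝒢 m) (a : A₀ m),
      iA m (g • a) = pointGalHom W (ringClassField K ι m) (ρ m g) (iA m a))
    (hyA : ∀ (m : ℕ) (hm : m ∣ n), iA m (y m) = (d m hm).y)
    (hσA : ∀ (m : ℕ) (hm : m ∣ n), ∀ q ∈ m.primeFactors, ρ m (σ m q) = (d m hm).σ q)
    (hL : ∀ m : ℕ, m ∣ n → L m = m.primeFactors)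
    (hfsec : ∀ m : ℕ, m ∣ n → ∀ c : 𝒢 m ⧸ H m, (f m c : 𝒢 m ⧸ H m) = c)
    (hHρ : ∀ m : ℕ, m ∣ n → ∀ h ∈ H m, ρ m h ∈ ringClassGalOver ι m 1) :
    ∀ m : ℕ, m ∣ n →
      j m (kolyvaginPoint (σ m) (L m) (f m) (y m)) ∈
        invPoints (absoluteGaloisGroup K) (j m).range ((p ^ M : ℕ) : ℤ) :=
  fun m hm => map_mem_invPoints_of_forall_smul_sub_mem (π m) (j m) (hj m)
    (smul_kolyvaginPoint_sub_mem_of_dvd_zhang hK ι Dt hp hND hD hn hkol d σ L H f y ρ hρ iA hiA hyA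
      hσA hL hfsec hHρ m hm)

/-! ## §2 The invariance clause for CONCRETE data at Zhang–Kolyvagin levels -/

/-- **`[P(m)]` is `Γ_K`-invariant mod `p^M` for the tree's CONCRETE Kolyvagin–Heegner data** at every
divisor `m ∣ n` of a square-free product `n` of Zhang–Kolyvagin primes of index `≥ M`, given data `d m`
at all `m ∣ n` (`K` imaginary quadratic, `(N, d_K) = 1`, `d_K < −4`):
`(d m).toGeomPoints (d m).derivedPoint ∈ invPoints Γ_K (d m).pointsSubgroup p^M` — McCallum's (4), the
standing input `hP` of `d.kolyvaginClass` and the invariance clause of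
`KolyCert.kolyvaginClass_ne_zero_iff`.  `kolyvaginPoint_mem_invPoints_of_dvd_zhang` instantiated at the
level data of `KolyvaginH44.exists_levelData` and transported to the concrete texts by
`KolyvaginH37Bridge.map_kolyvaginPoint_eq_derivedPoint` / `bijOn_of_section_of_transversal`, exactly as in
`Three.h44_concrete_at_three_of_congruence`. [cite: McCallumLMS1991, §4 (4)]
[cite: GrossLMS1991, Prop. 3.6, §4 (4.1)] -/
theorem toGeomPoints_derivedPoint_mem_invPoints_of_dvd_zhang (hK : IsImaginaryQuadratic K)
    (ι : K →+* ℂ) [NeZero N] [W.IsElliptic] [W.IsGloballyMinimal] (Dt : ModularParametrizationData W N)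
    {β : ℤ} {p M : ℕ} (hp : p.Prime)
    (hND : IsCoprime (N : ℤ) (NumberField.discr K)) (hD : NumberField.discr K < -4) {n : ℕ}
    (hn : Squarefree n)
    (hkol : ∀ q ∈ n.primeFactors,
      Zhang2014.IsKolyvaginPrime N W K p q ∧ M ≤ Zhang2014.kolyvaginIndex W p q)
    (d : (m : ℕ) → m ∣ n → KolyvaginHeegnerData Dt β ι m) :
    ∀ (m : ℕ) (hm : m ∣ n),
      (d m hm).toGeomPoints (d m hm).derivedPoint ∈
        invPoints (absoluteGaloisGroup K) (d m hm).pointsSubgroup ((p ^ M : ℕ) : ℤ) := by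
  have hinert : ∀ q ∈ n.primeFactors, (Ideal.span {(q : 𝓞 K)}).IsPrime :=
    fun q hq ↦ (hkol q hq).1.2.2.2.2.1
  -- level data at every level (x11b3-p2's `exists_levelData`)
  choose σ H f y π j e hord hj hπρ hfsec hHρ hdict hjunk using
    fun k ↦ KolyvaginH44.exists_levelData (W := W) (Dt := Dt) (β := β) hK ι hn hinert d k
  -- `𝒢_m = ringClassGal ι m`, a finite commutative group acting on `E(K[m])` through `pointGalHom`
  letI hcg : ∀ k, CommGroup (ringClassGal ι k) := fun k ↦
    { (inferInstance : Group (ringClassGal ι k)) with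
      mul_comm := fun a b ↦ (KolyvaginH44.isMulCommutative_ringClassGal' hK ι k).is_comm.comm a b }
  haveI hfin : ∀ k, Finite (ringClassGal ι k) := KolyvaginH44.finite_ringClassGal hK ι
  letI act : ∀ k, DistribMulAction (ringClassGal ι k)
      ((W.baseChange (ringClassField K ι k)).toAffine.Point) := fun k ↦
    DistribMulAction.compHom _ ((pointGalHom W (ringClassField K ι k)).comp (ringClassGal ι k).subtype)
  letI hft : ∀ k, Fintype (ringClassGal ι k ⧸ H k) := fun k ↦ Fintype.ofFinite _
  have hsmul : ∀ (k) (g : ringClassGal ι k) (Q : (W.baseChange (ringClassField K ι k)).toAffine.Point),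
      g • Q = pointGalHom W (ringClassField K ι k)
        (g : ringClassField K ι k ≃ₐ[ℚ] ringClassField K ι k) Q := fun _ _ _ ↦ rfl
  -- the inclusion `ρ_m : 𝒢_m ≤ Aut_ℚ(K[m])` (the identity `iA_m` is `AddEquiv.refl`)
  set ρ : ∀ k, ringClassGal ι k →* (ringClassField K ι k ≃ₐ[ℚ] ringClassField K ι k) :=
    fun k ↦ (ringClassGal ι k).subtype with hρdef
  have hρ : ∀ k, Function.Injective (ρ k) := fun k ↦ (ringClassGal ι k).subtype_injective
  have hj' : ∀ (k) (g : absoluteGaloisGroup K)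
      (a : (W.baseChange (ringClassField K ι k)).toAffine.Point),
      j k (π k g • a) = g • j k a := fun k g a ↦ by rw [hsmul]; exact hj k g a
  -- the abstract Kolyvagin point IS `P(m)` at the divisors (x11b3-p8's G1)
  have hP : ∀ (k) (hk : k ∣ n),
      j k (kolyvaginPoint (σ k) k.primeFactors (f k) (y k)) =
        (d k hk).toGeomPoints (d k hk).derivedPoint := by
    intro k hk
    obtain ⟨hjk, hyk, hσk, hfS⟩ := hdict k hk
    rw [hjk, hyk]
    congr 1
    have hbij := KolyvaginH37Bridge.bijOn_of_section_of_transversal (ρ k) (hρ k)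
      (H := H k) (Γ := ringClassGal ι k) (G₁ := ringClassGalOver ι k 1) (hHρ k)
      (S := ((d k hk).S : Set _)) (fun s hs ↦ (d k hk).S_subset s hs)
      (fun s hs ↦ ⟨⟨s, (d k hk).S_subset s hs⟩, rfl⟩) (d k hk).S_transversal (f k) (hfsec k) hfS
    exact KolyvaginH37Bridge.map_kolyvaginPoint_eq_derivedPoint
      (pointGalHom W (ringClassField K ι k)) (ρ k) (AddMonoidHom.id _) (fun g a ↦ hsmul k g a)
      (hn.squarefree_of_dvd hk) hσk (f k) hbij (d k hk).y
  -- the dictionary clauses the abstract END reads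
  have hyA : ∀ (k : ℕ) (hk : k ∣ n), AddEquiv.refl _ (y k) = (d k hk).y :=
    fun k hk ↦ (hdict k hk).2.1
  have hσA : ∀ (k : ℕ) (hk : k ∣ n), ∀ q ∈ k.primeFactors, ρ k (σ k q) = (d k hk).σ q :=
    fun k hk ↦ (hdict k hk).2.2.1
  intro k hk
  have h := kolyvaginPoint_mem_invPoints_of_dvd_zhang hK ι Dt hp hND hD hn hkol d σ
    (fun k ↦ k.primeFactors) H f y π j hj' ρ hρ (fun _ ↦ AddEquiv.refl _)
    (fun k _ g a ↦ hsmul k g a) hyA hσA (fun _ _ ↦ rfl) (fun k _ ↦ hfsec k) (fun k _ ↦ hHρ k) k hk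
  rw [hP k hk, (hdict k hk).1] at h
  exact h

/-! ## §3 The crux from ONE derived-point certificate on a tower -/

/-- **On the crux's binders, a tower certificate gives a NON-ZERO `c₁(n)`.**  For `E = W/ℚ` elliptic,
globally minimal, with multiplicative reduction at `3` (so `3 ∣ N`), `ρ̄_{E,3}` onto, `K` imaginary
quadratic with the Heegner hypothesis for `N` (so `(N, d_K) = 1`; with `3 ∣ N` and the orientation,
`d_K < −4`, `Three.discr_lt_neg_four_of_isCoprime_of_dvd_sq_sub`), a frame `(Dt, β, ι)`, a square-free
product `n` of Zhang–Kolyvagin primes for `p = 3`, and Kolyvagin–Heegner data `d m` at every `m ∣ n`: if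
`P(n) ∉ 3·E(K[n])` then `(d n).kolyvaginClass Nat.prime_three 1 ≠ 0` — the invariance clause is SUPPLIED
(§2 at `M = 1`, `1 ≤ M(q)` being part of `Zhang2014.IsKolyvaginPrime`), admissibility from `Surj W 3`
(`KolyCert.kolyvaginClass_three_ne_zero_iff`). [cite: McCallumLMS1991, §4 (4), Cor. 4.5]
[cite: GrossLMS1991, Prop. 3.6, Lemma 4.3, Prop. 4.7 (1)] -/
theorem kolyvaginClass_three_ne_zero_of_tower_not_pDiv (W : WeierstrassCurve ℚ) [W.IsElliptic]
    [W.IsGloballyMinimal] [NeZero (W.conductorNorm ℤ)] (K : Type) [Field K] [NumberField K]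
    (Dt : ModularParametrizationData W (W.conductorNorm ℤ)) (β : ℤ) (ι : K →+* ℂ)
    (hmult : W.HasMultiplicativeReductionAtPrime 3) (hsurj : Rank1Residual.Surj W 3)
    (hK : IsImaginaryQuadratic K) (hH : SatisfiesHeegnerHypothesis (W.conductorNorm ℤ) K)
    {n : ℕ} (hn : KolyvaginDescent.KolSupp (Zhang2014.IsKolyvaginPrime (W.conductorNorm ℤ) W K 3) n)
    (d : (m : ℕ) → m ∣ n → KolyvaginHeegnerData Dt β ι m)
    (hcert : ¬ PDiv (d n dvd_rfl) 3 1) :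
    (d n dvd_rfl).kolyvaginClass Nat.prime_three 1 ≠ 0 := by
  haveI : Fact (Nat.Prime 3) := ⟨Nat.prime_three⟩
  -- `(N, d_K) = 1` from the Heegner hypothesis
  have hND : IsCoprime (W.conductorNorm ℤ : ℤ) (NumberField.discr K) := by
    have h := Literature.SatisfiesHeegnerHypothesis.coprime_discr hK.1 hH
    refine Int.isCoprime_iff_gcd_eq_one.mpr ?_
    rw [Int.gcd_eq_natAbs, Int.natAbs_natCast]
    exact h
  -- `3 ∣ N` from multiplicative reduction at `3`
  have h3 : 3 ∣ W.conductorNorm ℤ :=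
    (W.dvd_conductorNorm_iff_not_hasGoodReductionAtPrime 3).mpr
      (WeierstrassCurve.HasMultiplicativeReduction.not_hasGoodReduction (R := ℤ_[3]) hmult)
  -- `d_K < -4` from `3 ∣ N`, `(N, d_K) = 1` and the orientation
  have hD : NumberField.discr K < -4 :=
    discr_lt_neg_four_of_isCoprime_of_dvd_sq_sub hK hND h3 (d n dvd_rfl).dvd_sq_sub
  have hkol : ∀ q ∈ n.primeFactors,
      Zhang2014.IsKolyvaginPrime (W.conductorNorm ℤ) W K 3 q ∧ 1 ≤ Zhang2014.kolyvaginIndex W 3 q :=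
    fun q hq ↦ ⟨hn.2 q hq, (hn.2 q hq).2.2.2.2.2⟩
  have hP := toGeomPoints_derivedPoint_mem_invPoints_of_dvd_zhang hK ι Dt Nat.prime_three hND hD hn.1
    hkol d n dvd_rfl
  exact (kolyvaginClass_three_ne_zero_iff (d n dvd_rfl) hK hn.1.ne_zero hsurj 1).mpr ⟨hP, hcert⟩

/-- **The crux from tower point certificates.**  `Theses.KolyvaginRoadThree.ZhangSharpFrameAtThree`
(Kolyvagin's conjecture mod 3 at `3 ∥ N` on atom A1, at every Manin-good conductor-1 frame) FOLLOWS from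
the pure point-divisibility statement: under the same binders, at every such frame there are a
square-free product `n` of Zhang–Kolyvagin primes for `p = 3` and Kolyvagin–Heegner data `d m` on the frame
at every level `m ∣ n` (the tower `y(m) ∈ E(K[m])`, Gross 1991 §3) such that the TOP derived point is not
divisible by 3 in `E(K[n])`: `¬ Koly.PDiv (d n) 3 1`.  No cohomology class, no invariance clause: the
latter is supplied by §2, admissibility by `Surj W 3`, the cocycle by McCallum's Cor. 4.5
(`KolyCert.kolyvaginClass_three_ne_zero_iff`).  This is the statement a derived-point computation
certifies (BC5 rung / WANTED-K3).  The converse (crux ⇒ tower form) needs Kolyvagin–Heegner data at the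
lower levels (CM rationality of `x_m`, the seam G-a shape at level `m`) and is NOT claimed.
[cite: McCallumLMS1991, §4 (4), Cor. 4.5] [cite: GrossLMS1991, §3, Prop. 3.6, §4 (4.1), Prop. 4.7 (1)] -/
theorem zhangSharpFrameAtThree_of_towerCertificates
    (h : ∀ (W : WeierstrassCurve ℚ) [W.IsElliptic] [W.IsGloballyMinimal] [NeZero (W.conductorNorm ℤ)]
      (K : Type) [Field K] [NumberField K]
      (Dt : ModularParametrizationData W (W.conductorNorm ℤ)) (β : ℤ) (ι : K →+* ℂ),
      W.HasMultiplicativeReductionAtPrime 3 → Rank1Residual.Surj W 3 → Rank1Residual.Ram W 3 →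
      ¬ 3 ∣ W.tamagawaProduct → IsImaginaryQuadratic K →
      SatisfiesHeegnerHypothesis (W.conductorNorm ℤ) K → NumberField.discr K ≠ -3 →
      (4 * (W.conductorNorm ℤ : ℤ)) ∣ β ^ 2 - NumberField.discr K → ¬ (3 : ℤ) ∣ Dt.c →
      ∃ (n : ℕ) (d : (m : ℕ) → m ∣ n → KolyvaginHeegnerData Dt β ι m),
        KolyvaginDescent.KolSupp (Zhang2014.IsKolyvaginPrime (W.conductorNorm ℤ) W K 3) n ∧
          ¬ PDiv (d n dvd_rfl) 3 1) :
    Summit.BirchSwinnertonDyer.BirchSwinnertonDyer.Theses.KolyvaginRoadThree.ZhangSharpFrameAtThree := by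
  intro W _ _ _ K _ _ Dt β ι hmult hsurj hram htam hK hH h3 hβ hc
  obtain ⟨n, d, hn, hcert⟩ := h W K Dt β ι hmult hsurj hram htam hK hH h3 hβ hc
  exact ⟨n, d n dvd_rfl, hn,
    kolyvaginClass_three_ne_zero_of_tower_not_pDiv W K Dt β ι hmult hsurj hK hH hn d hcert⟩

end Summit.BirchSwinnertonDyer.Rank1Residual.X11b.Three.KolyCert

end
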